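import Literature.MathematicalPhysics.QuantumLattice.IsotropicPropagatorDecay
import HarnessLib

/-!
# Moment bounds of the isotropic single-scale propagators (BGM 2006, (2.52b))

Topic `Literature/MathematicalPhysics/QuantumLattice`; a corollary of `IsotropicPropagatorDecay`
(Lemma 2.3 (2.60)). BGM 2006, Remark after Lemma 2.3: "(2.60) implies the analogue of (2.52a):
`∫ dx |x|^j |ḡ^{(h)}_ω̄(x)| ≤ C_j γ^{-(1+j)h}`, `j ≥ 0` (2.52b)". PROVED here for every `j`, with
`|x|` the norm of `x = (x₀, x⃗) ∈ ℝ × ℝ²` (the sup norm of the product; any equivalent norm changes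
only `C_j`):

* `norm_isoChartAdj_dualPoint` — `‖isoChartAdj(ξ(x₀,x⃗))‖ = 4^{-n} √(x₀² + |x⃗|²)/(2π)` (orthonormal frame);
* `norm_le_mul_norm_isoChartAdj` — `‖(x₀, x⃗)‖ ≤ 2π 4ⁿ ‖isoChartAdj(ξ)‖`;
* **`isoPropagator_moment`** — there is `C_j` with `|x|^j ḡ ∈ L¹` and
  `∫ |x|^j ‖ḡ^{(-n)}_ω̄(x)‖ dx ≤ C_j 4^{n(1+j)}` (`= C_j γ^{-(1+j)h}`) for all `n`, `0 ≤ ω̄ < 2·4ⁿ`.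

Everything is PROVED; no new definitions.

## Sources

* G. Benfatto, A. Giuliani, V. Mastropietro, Ann. Henri Poincaré 7 (2006) 809–898, §2.5
  Remark after Lemma 2.3, (2.52b) (arXiv:cond-mat/0507686 p. 12). [BenfattoGiulianiMastropietro2006]
-/

noncomputable section

open Real Set Complex Function Metric MeasureTheory MeasureTheory.Measure Module
open scoped Topology
open Literature.Analysis.Fourier

namespace Literature.MathematicalPhysics.QuantumLattice

section Moments

variable {μ : ℝ} (hμ₁ : -4 < μ) (hμ₂ : μ < -2 - Real.sqrt 2)
include hμ₁ hμ₂

/-- In the orthonormal frame `(n·x⃗)² + (τ·x⃗)² = |x⃗|²`. [folklore] -/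
theorem frame_normSq (θ₀ : ℝ) (x : Fin 2 → ℝ) :
    (fermiNormal μ θ₀ 0 * x 0 + fermiNormal μ θ₀ 1 * x 1) ^ 2 + (fermiTangent μ θ₀ 0 * x 0 + fermiTangent μ θ₀ 1 * x 1) ^ 2 =
      x 0 ^ 2 + x 1 ^ 2 := by
  have hn := fermiNormal_normSq hμ₁ hμ₂ θ₀
  have hτ := fermiTangent_normSq hμ₁ hμ₂ θ₀
  have hdet := det_fermiFrameMatrix hμ₁ hμ₂ θ₀
  rw [fermiFrameMatrix, Matrix.det_fin_two_of] at hdet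
  set a := fermiNormal μ θ₀ 0
  set b := fermiNormal μ θ₀ 1
  set c := fermiTangent μ θ₀ 0
  set d := fermiTangent μ θ₀ 1
  -- a rotation: `(a - d)² + (b + c)² = 0`
  have hsq : (a - d) ^ 2 + (b + c) ^ 2 = 0 := by linear_combination hn + hτ - 2 * hdet
  have had : a = d := by nlinarith [sq_nonneg (a - d), sq_nonneg (b + c)]
  have hbc : c = -b := by nlinarith [sq_nonneg (a - d), sq_nonneg (b + c)]
  rw [hbc, ← had]
  linear_combination (x 0 ^ 2 + x 1 ^ 2) * hn

/-- **`‖isoChartAdj(ξ(x₀, x⃗))‖ = 4^{-n} √(x₀² + |x⃗|²)/(2π)`.** [folklore] -/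
theorem norm_isoChartAdj_dualPoint (θ₀ : ℝ) (n : ℕ) (x₀ : ℝ) (x : Fin 2 → ℝ) :
    ‖isoChartAdj μ θ₀ n (dualPoint x₀ x)‖ = (4 : ℝ) ^ (-(n : ℤ)) / (2 * π) * Real.sqrt (x₀ ^ 2 + (x 0 ^ 2 + x 1 ^ 2)) := by
  have h4 : 0 < (4 : ℝ) ^ (-(n : ℤ)) := zpow_pos (by norm_num) _
  have hframe := frame_normSq hμ₁ hμ₂ θ₀ x
  rw [EuclideanSpace.norm_eq, Fin.sum_univ_three]
  simp only [isoChartAdj, dualPoint, PiLp.toLp_apply, Matrix.cons_val_zero, Matrix.cons_val_one, Matrix.cons_val_two,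
    Matrix.tail_cons, Matrix.head_cons, Real.norm_eq_abs, sq_abs]
  rw [← Real.sqrt_sq (by positivity : 0 ≤ (4 : ℝ) ^ (-(n : ℤ)) / (2 * π)), ← Real.sqrt_mul (sq_nonneg _)]
  congr 1
  have hπ : (2 * π) ≠ 0 := by positivity
  field_simp
  linear_combination hframe

omit hμ₁ hμ₂ in
/-- The sup norm of `(x₀, x⃗)` is at most the Euclidean one. [folklore] -/
theorem norm_prod_le_sqrt (x₀ : ℝ) (x : Fin 2 → ℝ) : ‖((x₀, x) : ℝ × (Fin 2 → ℝ))‖ ≤ Real.sqrt (x₀ ^ 2 + (x 0 ^ 2 + x 1 ^ 2)) := by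
  rw [Prod.norm_def]
  refine max_le ?_ ?_
  · rw [Real.norm_eq_abs, ← Real.sqrt_sq_eq_abs]
    exact Real.sqrt_le_sqrt (by nlinarith [sq_nonneg (x 0), sq_nonneg (x 1)])
  · refine (pi_norm_le_iff_of_nonneg (Real.sqrt_nonneg _)).2 fun i => ?_
    rw [Real.norm_eq_abs, ← Real.sqrt_sq_eq_abs]
    fin_cases i <;> exact Real.sqrt_le_sqrt (by simp; nlinarith [sq_nonneg x₀, sq_nonneg (x 0), sq_nonneg (x 1)])

/-- **`‖(x₀, x⃗)‖ ≤ 2π 4ⁿ ‖isoChartAdj(ξ)‖`.** [folklore] -/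
theorem norm_le_mul_norm_isoChartAdj (θ₀ : ℝ) (n : ℕ) (x₀ : ℝ) (x : Fin 2 → ℝ) :
    ‖((x₀, x) : ℝ × (Fin 2 → ℝ))‖ ≤ 2 * π * (4 : ℝ) ^ n * ‖isoChartAdj μ θ₀ n (dualPoint x₀ x)‖ := by
  rw [norm_isoChartAdj_dualPoint hμ₁ hμ₂]
  have h44 : (4 : ℝ) ^ n * (4 : ℝ) ^ (-(n : ℤ)) = 1 := by rw [zpow_neg, zpow_natCast, mul_inv_cancel₀ (by positivity)]
  have hπ : (2 * π) ≠ 0 := by positivity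
  calc ‖((x₀, x) : ℝ × (Fin 2 → ℝ))‖ ≤ Real.sqrt (x₀ ^ 2 + (x 0 ^ 2 + x 1 ^ 2)) := norm_prod_le_sqrt x₀ x
    _ = 2 * π * (4 : ℝ) ^ n * ((4 : ℝ) ^ (-(n : ℤ)) / (2 * π) * Real.sqrt (x₀ ^ 2 + (x 0 ^ 2 + x 1 ^ 2))) := by
        rw [zpow_neg, zpow_natCast]
        field_simp

omit hμ₁ hμ₂ in
/-- `a^j ((1+a)^{j+4})⁻¹ ≤ ((1+a)^4)⁻¹` for `a ≥ 0`. [folklore] -/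
theorem pow_mul_inv_pow_le {a : ℝ} (ha : 0 ≤ a) (j : ℕ) : a ^ j * ((1 + a) ^ (j + 4))⁻¹ ≤ ((1 + a) ^ 4)⁻¹ := by
  have h1 : 0 < 1 + a := by linarith
  rw [pow_add, mul_inv, ← mul_assoc]
  refine mul_le_of_le_one_left (by positivity) ?_
  rw [mul_inv_le_iff₀ (by positivity), one_mul]
  exact pow_le_pow_left₀ ha (by linarith) j

/-- **The moment bounds (2.52b)**: for every `j` there is `C_j` with `|x|^j ḡ^{(h)}_ω̄ ∈ L¹` and
`∫ |x|^j |ḡ^{(-n)}_ω̄(x)| dx ≤ C_j 4^{n(1+j)}` (`= C_j γ^{-(1+j)h}`) for all `n` and all isotropic sectors. [cite: BenfattoGiulianiMastropietro2006, §2.5 (2.52b)] -/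
theorem isoPropagator_moment {e₀ : ℝ} (he : 0 < e₀) (he' : e₀ ≤ (4 + μ) / 2) (j : ℕ) :
    ∃ C : ℝ, 0 ≤ C ∧ ∀ (n : ℕ) (ω : ℕ), ω < sectorCount (2 * n) →
      Integrable (fun p : ℝ × (Fin 2 → ℝ) => ‖p‖ ^ j * ‖isoPropagator e₀ μ n ω p.1 p.2‖) ∧
        ∫ p : ℝ × (Fin 2 → ℝ), ‖p‖ ^ j * ‖isoPropagator e₀ μ n ω p.1 p.2‖ ≤ C * ((4 : ℝ) ^ n) ^ (1 + j) := by
  obtain ⟨C₀, hC₀, hdec⟩ := isoPropagator_decay hμ₁ hμ₂ he he' (j + 4)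
  set I : ℝ := ∫ u : MomSpace, ((1 + ‖u‖) ^ 4)⁻¹ with hI
  have hI0 : 0 ≤ I := integral_nonneg fun u => by positivity
  refine ⟨C₀ * (2 * π) ^ j * (2 * π) ^ 3 * I, by positivity, fun n ω hω => ?_⟩
  set θ₀ : ℝ := ((ω : ℝ) + 1 / 2) * sectorWidth (2 * n) with hθ₀
  set W := isoDualEquiv hμ₁ hμ₂ θ₀ n with hW
  set F : MomSpace → ℝ := fun u => ((1 + ‖u‖) ^ 4)⁻¹ with hF
  set g : ℝ × (Fin 2 → ℝ) → ℝ := fun p => ‖p‖ ^ j * ‖isoPropagator e₀ μ n ω p.1 p.2‖ with hg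
  -- `‖p‖^j ‖ḡ(p)‖ ≤ c F(S p)` with `c = C₀ (2π 4ⁿ)^j 4^{-2n}`
  set c : ℝ := C₀ * (2 * π * (4 : ℝ) ^ n) ^ j * ((4 : ℝ) ^ (-(n : ℤ)) * (4 : ℝ) ^ (-(n : ℤ))) with hc
  have hc0 : 0 ≤ c := by positivity
  set b : ℝ × (Fin 2 → ℝ) → ℝ := fun p => c * F (isoChartAdj μ θ₀ n (dualPoint p.1 p.2)) with hb
  have hgb : ∀ p, ‖g p‖ ≤ b p := fun p => by
    set a : ℝ := ‖isoChartAdj μ θ₀ n (dualPoint p.1 p.2)‖ with ha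
    have ha0 : 0 ≤ a := norm_nonneg _
    have hdp := hdec n ω hω p.1 p.2
    rw [← hθ₀, ← ha] at hdp
    have hnorm : ‖p‖ ≤ 2 * π * (4 : ℝ) ^ n * a := by
      have := norm_le_mul_norm_isoChartAdj hμ₁ hμ₂ θ₀ n p.1 p.2
      rwa [Prod.mk.eta] at this
    have hpj : ‖p‖ ^ j ≤ (2 * π * (4 : ℝ) ^ n) ^ j * a ^ j := by
      rw [← mul_pow]; exact pow_le_pow_left₀ (norm_nonneg _) hnorm j
    rw [hg, hb, hF]
    simp only [Real.norm_eq_abs, abs_mul, abs_pow, abs_norm]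
    calc ‖p‖ ^ j * ‖isoPropagator e₀ μ n ω p.1 p.2‖
        ≤ ((2 * π * (4 : ℝ) ^ n) ^ j * a ^ j) * (C₀ * ((4 : ℝ) ^ (-(n : ℤ)) * (4 : ℝ) ^ (-(n : ℤ))) * ((1 + a) ^ (j + 4))⁻¹) :=
          mul_le_mul hpj hdp (norm_nonneg _) (by positivity)
      _ = c * (a ^ j * ((1 + a) ^ (j + 4))⁻¹) := by rw [hc]; ring
      _ ≤ c * ((1 + a) ^ 4)⁻¹ := mul_le_mul_of_nonneg_left (pow_mul_inv_pow_le ha0 j) hc0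
  -- `b ∘ splitMomentum = c • (F ∘ W)` and its integral (as in the `L¹` bound)
  have hbW : (b ∘ splitMomentum) = fun q => c * F (W q) := by
    funext q
    simp only [Function.comp_apply, hb, splitMomentum_apply, hW, isoDualEquiv_apply]
  have hdetW : LinearMap.det ((W : MomSpace ≃ₗ[ℝ] MomSpace) : MomSpace →ₗ[ℝ] MomSpace) ≠ 0 := by
    rw [hW, det_isoDualEquiv hμ₁ hμ₂]; positivity
  have hFW : Integrable (fun q => F (W q)) := by
    have hmap : Measure.map (W : MomSpace → MomSpace) volume =
        ENNReal.ofReal |(LinearMap.det ((W : MomSpace ≃ₗ[ℝ] MomSpace) : MomSpace →ₗ[ℝ] MomSpace))⁻¹| • volume :=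
      map_linearMap_addHaar_eq_smul_addHaar volume hdetW
    have h1 : Integrable F (Measure.map (W : MomSpace → MomSpace) volume) := by
      rw [hmap]; exact integrable_inv_one_add_norm_pow_four.smul_measure ENNReal.ofReal_ne_top
    exact (integrable_map_equiv W.toHomeomorph.toMeasurableEquiv F).1 h1
  have hintFW : ∫ q, F (W q) = (2 * π) ^ 3 * ((4 : ℝ) ^ n * (4 : ℝ) ^ n * (4 : ℝ) ^ n) * I := by
    rw [integral_comp_continuousLinearEquiv volume W F, det_isoDualEquiv hμ₁ hμ₂, smul_eq_mul, ← hI]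
    congr 1
    rw [abs_of_pos (by positivity), inv_div, zpow_neg, zpow_natCast]
    field_simp
  have hbi : Integrable b := by
    rw [← measurePreserving_splitMomentum.integrable_comp_emb splitMomentum.measurableEmbedding, hbW]
    exact hFW.const_mul c
  have hbint : ∫ p, b p = C₀ * (2 * π) ^ j * (2 * π) ^ 3 * I * ((4 : ℝ) ^ n) ^ (1 + j) := by
    rw [← measurePreserving_splitMomentum.integral_comp splitMomentum.measurableEmbedding]
    change ∫ q, (b ∘ splitMomentum) q = _
    rw [hbW, integral_const_mul, hintFW, hc]
    have h4 : (4 : ℝ) ^ (-(n : ℤ)) * (4 : ℝ) ^ n = 1 := by rw [zpow_neg, zpow_natCast, inv_mul_cancel₀ (by positivity)]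
    rw [pow_add, pow_one, mul_pow]
    linear_combination (C₀ * (2 * π) ^ j * ((4 : ℝ) ^ n) ^ j * (2 * π) ^ 3 * I * (4 : ℝ) ^ n *
      ((4 : ℝ) ^ (-(n : ℤ)) * (4 : ℝ) ^ n + 1)) * h4
  -- conclude
  have hgm : AEStronglyMeasurable g volume :=
    ((continuous_norm.pow j).mul (continuous_isoPropagator hμ₁ hμ₂ he he' n ω).norm).aestronglyMeasurable
  have hgi : Integrable g := Integrable.mono' hbi hgm (ae_of_all _ hgb)
  refine ⟨hgi, ?_⟩
  have hgg : ∀ p, g p ≤ b p := fun p => le_trans (le_abs_self _) (by simpa [Real.norm_eq_abs] using hgb p)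
  calc ∫ p, g p ≤ ∫ p, b p := integral_mono hgi hbi hgg
    _ = C₀ * (2 * π) ^ j * (2 * π) ^ 3 * I * ((4 : ℝ) ^ n) ^ (1 + j) := hbint

end Moments

end Literature.MathematicalPhysics.QuantumLattice

end
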